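import Summits.QuantumFields.YangMills.Theorems.BalabanUVNodesN11NoExpansionStepSpecification
import Summits.QuantumFields.YangMills.Theorems.BalabanUVNodesN11NoExpansionStepSpecificationOfTermRows
import Summits.QuantumFields.YangMills.Theorems.BalabanUVNodesN11AFibreDominationOfCoercive

/-!
# DAG node N11 — THE COERCIVE EDITION OF THE NO-EXPANSION 𝐓-STEP SPECIFICATION AT A GENERIC `θ`: dag-n11-d's witness-first specification
# `…N11NoExpansionStepSpecification` with its per-branch A-FIBRE DOMINATION row («∀ S ∈ admS, ∀ j, ∃ ŵ measurable, ∫⁻ ŵ ≠ ⊤, ofReal (w_j …) ≤ ŵ (A|sA)»)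
# REPLACED by ONE pointwise row on the VALUE of the residual's `quad` — coercivity `c_j·Σ_{b∈sA_j} ‖A_j(b)‖² ≤ quad_j(Λ_{j+1})` ([I]'s positivity of `𝒬_j`)

HEADER — WORK-UNIT METADATA.  Cell `pub-ymgap`, YM-PLAN Track A (HUMAN RULING D-0062 ∕ D-0149), WIDTH SEAT `pub-ymgap-dag-n11-w4` (g0) on NODE n11 [B14];
route `BalabanUVNodes` rev 25, item K1⁷ `StabilityBAtRecordR13SepCoPH` = stmt-QuantumFields-20542 (helper, `--kind proof --supports 20542 --as helper`, count-neutral).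
INTENT-2 of this seat: composition of dag-n11-d g10's INTENT-10 (★★★ `exists_local_witness_clause_succ_of_sLaw₁₃CoPH_of_rows`) with this seat's INTENT-1
(`…N11AFibreDominationOfCoercive.afibre_rows_adm_of_coercive`).  [III] = [Balaban1988Convergent], [I] = [Balaban1987RG1].

WHAT THIS FILE PROVES (0 `sorry`, 0 `def`).  ★★★ `exists_local_witness_clause_succ_of_sLaw₁₃CoPH_of_coercive` — from `Provisos₁₃CoPH`, `ZhUnity`, `k < K`,
`1 ≤ M`, `SLaw₁₃CoPH θ p k`: law-abiding `k`-local `(t, E_k)` with the level-`k` dichotomy such that at EVERY no-expansion history `s′` the 𝐓-image clause holds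
for `(t (init s′), E_k(init s′))` PROVIDED, for the residual `θ.zhAt p s′`: (P) prefix agreement · (V) the generation-`k` pin · `quad_k(∅) = 0` on two-scale
configurations · `k`-locality of `quad_j(Λ_{j+1})` · measurability of `ζ0`∕`quad` · **COERCIVITY of `quad_j(Λ_{j+1})` on the A-fibre** (one `c_j > 0` per generation;
[I]'s positivity, DISPLAYED) · the operand rows of the witness (def-T ∕ def-R; dag-n11-d's INTENT-11 derives them from term rows).  Every row is a property of the VALUE
of `θ.Zh` or of the term data — no `∃ ŵ`, no iterated transport, no locality binder on the weights.

HONEST FRAMING.  Helper lane of K1⁷; a two-line composition of accepted kernel theorems; nothing of Bałaban's asserted ([I]'s positivity of `𝒬_j` is a displayed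
row); no law of record edited or posited.  N11 NOT discharged; K1⁷ NOT closed; counts unmoved (typed 28∕28 · discharged 5∕27).  One finite four-torus programme at
fixed `ε = L^{−K}`; R4 closes only the conditional finite-𝕋⁴ rung `BalabanLadder.UV` — NOT ℝ⁴, NOT OS, NOT a mass gap, NOT Clay.  No `sorry`, `axiom`, `def`,
`instance`, `notation`.
Sources (SHAPE only): [III] Theorem p.245, (2.17)–(2.18) p.257, (2.20)–(2.25) pp.258–259, (3.16)–(3.21) pp.268–269, (3.23)–(3.25) p.270, Thm 1 p.262; [I] (1.4)–(1.5) pp.260–261, (2.11) p.267.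
-/

noncomputable section

open MeasureTheory
open scoped BigOperators ENNReal NNReal Matrix.Norms.L2Operator

namespace Summit.QuantumFields.YangMills.Theorems.BalabanUVNodesN11NoExpansionStepSpecificationOfCoercive

open Literature.MathematicalPhysics.QuantumFieldTheory.Balaban1983to89 T4Continuum Node00 Node00.Tk
open B15DeterminingSets (MSField)
open B10Eq42TorusConstraint (bondsIn)
open BalabanUVNodesN11FluctTruncationDefs (IsFluctLocal)
open BalabanUVNodesN11NoExpansionStepSpecification (exists_local_witness_clause_succ_of_sLaw₁₃CoPH_of_rows)
open BalabanUVNodesN11NoExpansionStepSpecificationOfTermRows (exists_local_witness_clause_succ_of_sLaw₁₃CoPH_of_termRows)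
open BalabanUVNodesN11AFibreDominationOfCoercive (afibre_rows_adm_of_coercive)

variable {F : T4Family} {N : ℕ} [NeZero N]

variable (θ : Stage13HParams F N) (p : B12.RunParams)

/-- **★★★ THE NO-EXPANSION 𝐓-STEP SPECIFICATION AT A GENERIC `θ`, COERCIVE EDITION**: dag-n11-d's ★★★ `exists_local_witness_clause_succ_of_sLaw₁₃CoPH_of_rows` with
the per-branch A-fibre domination row REPLACED by coercivity of `quad_j(Λ_{j+1}(init s′))` on the A-fibre `bondsIn j (Λᶜ_{j+1} ∩ Ω_{j+1})(init s′)` — one constant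
`c_j > 0` per generation ([I]'s positivity of `𝒬_j`, displayed).  Row order: run∕numerics (`h`, `hU`, `hk`, `hM`, `hS`); per no-expansion history `s′`: (P) `hpre`,
(V) `hZ`, `hq`, `hqloc`, measurability of `ζ0`∕`quad`, COERCIVITY, operand rows. [cite: Balaban1988Convergent, Theorem p.245, Thm 1 p.262, (3.24)–(3.25) p.270, (2.18) p.257, (2.20)–(2.23) p.258, (3.16)–(3.21) pp.268–269; Balaban1987RG1, (2.11) p.267 (shape of the row)] -/
theorem exists_local_witness_clause_succ_of_sLaw₁₃CoPH_of_coercive (h : θ.Provisos₁₃CoPH F N) (hU : θ.ZhUnity F N) {k : ℕ} (hk : k < p.K)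
    (hM : 1 ≤ θ.τ9.M) (hS : SLaw₁₃CoPH F N θ p k) :
    ∃ (t : SeqOfRecord F θ.ν θ.τ9.M (gOfRecord₁₃ F N θ.toStage13Params p) p.K k → Sect2.TermValues (F.P p.K) (MatA N) (FluctV N) θ.τ9.M)
      (Ek : SeqOfRecord F θ.ν θ.τ9.M (gOfRecord₁₃ F N θ.toStage13Params p) p.K k → ℝ),
      HasSect2FormAtZS F N (FluctV N) p.K (settingOfRecord₁₃ F N θ.toStage13Params p) k (θ.rzAt p) (WtOfRecord₁₃H F N θ p)
          (UbgOfRecord₁₃CoP F N θ.toStage13Params p k)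
          (fun s₀ t₀ => Sect2.LawsRT (sect2TowerOfRecord F N (FluctV N) p.K (settingOfRecord₁₃ F N θ.toStage13Params p) (θ.rzAt p s₀) s₀ t₀)
            (settingOfRecord₁₃ F N θ.toStage13Params p).lf k)
          (slotsOfRecord F N θ.ν θ.τ9 (EOfRecord₁₃ F N θ.toStage13Params) (wOfRecord₉ F N θ.toStage9Params) θ.ppSel p
            (gOfRecord₁₃ F N θ.toStage13Params p) k) t Ek ∧
      (∀ s₀, IsFluctLocal k (t s₀)) ∧
      ∀ (s : SeqOfRecord F θ.ν θ.τ9.M (gOfRecord₁₃ F N θ.toStage13Params p) p.K (k + 1)), s.Ω (k + 1) = ∅ →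
        -- (P) prefix agreement below `k`
        (∀ j, j < k → (θ.zhAt p s).ζ0 j = (θ.zhAt p s.init).ζ0 j ∧ (θ.zhAt p s).quad j = (θ.zhAt p s.init).quad j) →
        -- (V) the generation-`k` pin with the old front factor
        (∀ (V' : GaugeField (F.P p.K) (k + 1) (SU N)) (U₀ : GaugeField (F.P p.K) k (SU N)),
          (θ.zhAt p s).ζ0 k Set.univ (pairCfgAt (V := FluctV N) k V' U₀) =
            chiSeqOfRecord F N θ.ν θ.τ9.M (gOfRecord₁₃ F N θ.toStage13Params p) p.K k s.init U₀ *
              wOfRecord₉ F N θ.toStage9Params p (gOfRecord₁₃ F N θ.toStage13Params p) k s U₀ ((avOfRecord F N p.K k).avg U₀)) →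
        -- `quad_k(∅) = 0` on the two-scale configurations
        (∀ (V' : GaugeField (F.P p.K) (k + 1) (SU N)) (U₀ : GaugeField (F.P p.K) k (SU N)), (θ.zhAt p s).quad k ∅ (pairCfgAt (V := FluctV N) k V' U₀) = 0) →
        -- `k`-locality of `quad_j(Λ_{j+1})`, `j < k`
        (∀ j, j < k → ∀ ω ω' : MultiCfg (F.P p.K) (SU N) (FluctV N), (∀ i, i ≤ k → ω i = ω' i) →
          (θ.zhAt p s).quad j (s.init.Λ (j + 1)) ω = (θ.zhAt p s).quad j (s.init.Λ (j + 1)) ω') →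
        -- measurability of the residual serving `s′`
        (∀ j (Y : Set (Site (F.P p.K) 0)), Measurable ((θ.zhAt p s).ζ0 j Y)) →
        (∀ j (Λ' : Set (Site (F.P p.K) 0)), Measurable ((θ.zhAt p s).quad j Λ')) →
        -- COERCIVITY of `quad_j(Λ_{j+1})` on the A-fibre ([I]'s positivity of `𝒬_j`; replaces the per-branch A-fibre domination row)
        (∀ j : ℕ, ∃ c : ℝ, 0 < c ∧ ∀ ω : MultiCfg (F.P p.K) (SU N) (FluctV N),
          c * ∑ b ∈ (Set.toFinite (bondsIn j ((s.init.Λ (j + 1))ᶜ ∩ s.init.Ω (j + 1)))).toFinset, ‖(ω j).2 b‖ ^ 2 ≤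
            (θ.zhAt p s).quad j (s.init.Λ (j + 1)) ω) →
        -- the operand rows of the witness (def-T ∕ def-R)
        (∀ S ∈ admSOfRecord F θ.ν θ.τ9.M (gOfRecord₁₃ F N θ.toStage13Params p) p.K k s.init,
          Measurable (fun ω : MultiCfg (F.P p.K) (SU N) (FluctV N) =>
            sect2Operand F N (FluctV N) p.K (settingOfRecord₁₃ F N θ.toStage13Params p) (θ.rzAt p s.init) s.init (t s.init) (Ek s.init)
                (UbgOfRecord₁₃CoP F N θ.toStage13Params p k s.init) (S, fun j => (ω j).2) (fun j => (ω j).1)) ∧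
          ∃ CΦ : ℝ, ∀ a U, sect2Operand F N (FluctV N) p.K (settingOfRecord₁₃ F N θ.toStage13Params p) (θ.rzAt p s.init) s.init (t s.init) (Ek s.init)
                (UbgOfRecord₁₃CoP F N θ.toStage13Params p k s.init) a U ≤ CΦ) →
        (slotsTOfRecord F N θ.ν θ.τ9 (EOfRecord₁₃ F N θ.toStage13Params) (wOfRecord₉ F N θ.toStage9Params) θ.ppSel p
            (gOfRecord₁₃ F N θ.toStage13Params p) (k + 1) s = 0 ∨
          ∀ᵐ V' ∂fieldMeasure (F.P p.K) (k + 1) (SU N),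
            chiSeqOfRecord F N θ.ν θ.τ9.M (gOfRecord₁₃ F N θ.toStage13Params p) p.K (k + 1) s V' ≠ 0 →
              slotsTOfRecord F N θ.ν θ.τ9 (EOfRecord₁₃ F N θ.toStage13Params) (wOfRecord₉ F N θ.toStage9Params) θ.ppSel p
                  (gOfRecord₁₃ F N θ.toStage13Params p) (k + 1) s V' =
                sect2Slot F N (FluctV N) p.K (settingOfRecord₁₃ F N θ.toStage13Params p) (θ.rzAt p s) (WtOfRecord₁₃H F N θ p s) s
                  (t s.init) (Ek s.init) (UbgOfRecord₁₃CoP F N θ.toStage13Params p (k + 1) s) V') := by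
  obtain ⟨t, Ek, hform, hloc, hstep⟩ := exists_local_witness_clause_succ_of_sLaw₁₃CoPH_of_rows θ p h hU hk hM hS
  exact ⟨t, Ek, hform, hloc, fun s hΩ hpre hZ hq hqloc hζm hqm hcoer hΦ =>
    hstep s hΩ hpre hZ hq hqloc hζm hqm (afibre_rows_adm_of_coercive θ p s hcoer) hΦ⟩

/-! ## Edition 2 (INTENT-3): the ALL-PRIMITIVE edition — coercivity row AND def-T's term rows (dag-n11-d's p586165 ∘ §3 of p584243) -/

/-- **★★★ THE NO-EXPANSION 𝐓-STEP SPECIFICATION AT A GENERIC `θ`, EVERY ROW ON A PRIMITIVE OF RECORD, COERCIVE EDITION**: dag-n11-d's p586165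
`exists_local_witness_clause_succ_of_sLaw₁₃CoPH_of_termRows` (K0b residual rows + A-fibre domination + def-T's six term rows; def-R's background-map row proved
inside) with the per-branch A-fibre domination row REPLACED by coercivity of `quad_j(Λ_{j+1}(init s′))` on the A-fibre ([I]'s positivity of `𝒬_j`, displayed).  After
this theorem the hypotheses of the no-expansion 𝐓-step at a generic `θ` are: run∕numerics; per no-expansion history the K0b VALUE rows (P), (V), `quad_k(∅) = 0`,
`k`-locality, measurability, COERCIVITY; and def-T's six term rows — nothing else. [cite: Balaban1988Convergent, Theorem p.245, Thm 1 p.262, (2.12) p.256, (2.18) p.257, (2.23)–(2.27) pp.258–259, (2.31) p.260, (2.41) p.261, (3.24)–(3.25) p.270; Balaban1987RG1, (2.11) p.267 (shape of the row)] -/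
theorem exists_local_witness_clause_succ_of_sLaw₁₃CoPH_of_coercive_of_termRows (h : θ.Provisos₁₃CoPH F N) (hU : θ.ZhUnity F N) {k : ℕ} (hk : k < p.K)
    (hM : 1 ≤ θ.τ9.M) (hS : SLaw₁₃CoPH F N θ p k) :
    ∃ (t : SeqOfRecord F θ.ν θ.τ9.M (gOfRecord₁₃ F N θ.toStage13Params p) p.K k → Sect2.TermValues (F.P p.K) (MatA N) (FluctV N) θ.τ9.M)
      (Ek : SeqOfRecord F θ.ν θ.τ9.M (gOfRecord₁₃ F N θ.toStage13Params p) p.K k → ℝ),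
      HasSect2FormAtZS F N (FluctV N) p.K (settingOfRecord₁₃ F N θ.toStage13Params p) k (θ.rzAt p) (WtOfRecord₁₃H F N θ p)
          (UbgOfRecord₁₃CoP F N θ.toStage13Params p k)
          (fun s₀ t₀ => Sect2.LawsRT (sect2TowerOfRecord F N (FluctV N) p.K (settingOfRecord₁₃ F N θ.toStage13Params p) (θ.rzAt p s₀) s₀ t₀)
            (settingOfRecord₁₃ F N θ.toStage13Params p).lf k)
          (slotsOfRecord F N θ.ν θ.τ9 (EOfRecord₁₃ F N θ.toStage13Params) (wOfRecord₉ F N θ.toStage9Params) θ.ppSel p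
            (gOfRecord₁₃ F N θ.toStage13Params p) k) t Ek ∧
      (∀ s₀, IsFluctLocal k (t s₀)) ∧
      ∀ (s : SeqOfRecord F θ.ν θ.τ9.M (gOfRecord₁₃ F N θ.toStage13Params p) p.K (k + 1)), s.Ω (k + 1) = ∅ →
        -- (P) prefix agreement below `k`
        (∀ j, j < k → (θ.zhAt p s).ζ0 j = (θ.zhAt p s.init).ζ0 j ∧ (θ.zhAt p s).quad j = (θ.zhAt p s.init).quad j) →
        -- (V) the generation-`k` pin with the old front factor
        (∀ (V' : GaugeField (F.P p.K) (k + 1) (SU N)) (U₀ : GaugeField (F.P p.K) k (SU N)),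
          (θ.zhAt p s).ζ0 k Set.univ (pairCfgAt (V := FluctV N) k V' U₀) =
            chiSeqOfRecord F N θ.ν θ.τ9.M (gOfRecord₁₃ F N θ.toStage13Params p) p.K k s.init U₀ *
              wOfRecord₉ F N θ.toStage9Params p (gOfRecord₁₃ F N θ.toStage13Params p) k s U₀ ((avOfRecord F N p.K k).avg U₀)) →
        -- `quad_k(∅) = 0` on the two-scale configurations
        (∀ (V' : GaugeField (F.P p.K) (k + 1) (SU N)) (U₀ : GaugeField (F.P p.K) k (SU N)), (θ.zhAt p s).quad k ∅ (pairCfgAt (V := FluctV N) k V' U₀) = 0) →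
        -- `k`-locality of `quad_j(Λ_{j+1})`, `j < k`
        (∀ j, j < k → ∀ ω ω' : MultiCfg (F.P p.K) (SU N) (FluctV N), (∀ i, i ≤ k → ω i = ω' i) →
          (θ.zhAt p s).quad j (s.init.Λ (j + 1)) ω = (θ.zhAt p s).quad j (s.init.Λ (j + 1)) ω') →
        -- measurability of the residual serving `s′`
        (∀ j (Y : Set (Site (F.P p.K) 0)), Measurable ((θ.zhAt p s).ζ0 j Y)) →
        (∀ j (Λ' : Set (Site (F.P p.K) 0)), Measurable ((θ.zhAt p s).quad j Λ')) →
        -- COERCIVITY of `quad_j(Λ_{j+1})` on the A-fibre ([I]'s positivity of `𝒬_j`; replaces the per-branch A-fibre domination row)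
        (∀ j : ℕ, ∃ c : ℝ, 0 < c ∧ ∀ ω : MultiCfg (F.P p.K) (SU N) (FluctV N),
          c * ∑ b ∈ (Set.toFinite (bondsIn j ((s.init.Λ (j + 1))ᶜ ∩ s.init.Ω (j + 1)))).toFinset, ‖(ω j).2 b‖ ^ 2 ≤
            (θ.zhAt p s).quad j (s.init.Λ (j + 1)) ω) →
        -- def-T: the term values of the witness at the parent history, READ AT THE EMBEDDED BACKGROUND, are measurable …
        (∀ (j : ℕ) (X : (Sect2.domSys (F.P p.K) θ.τ9.M j).Dom) (z : Site (F.P p.K) j) (g' : ℝ),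
          Measurable (fun U : GaugeField (F.P p.K) 0 (SU N) => ((t s.init).E j X z g' (Sect2.ofBackgroundC (settingOfRecord₁₃ F N θ.toStage13Params p).ι U)).re)) →
        (∀ (j : ℕ) (X : (Sect2.domSys (F.P p.K) θ.τ9.M j).Dom),
          Measurable (fun U : GaugeField (F.P p.K) 0 (SU N) => ((t s.init).R j X (Sect2.ofBackgroundC (settingOfRecord₁₃ F N θ.toStage13Params p).ι U)).re)) →
        (∀ (S' : ℕ → Set (Site (F.P p.K) 0)) (j : ℕ) (X : (Sect2.domSys (F.P p.K) θ.τ9.M j).Dom),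
          Measurable (fun q : GaugeField (F.P p.K) 0 (SU N) × MSFluct (F.P p.K) (FluctV N) =>
            ((t s.init).B j X (Sect2.ofBackgroundC (settingOfRecord₁₃ F N θ.toStage13Params p).ι q.1) (S', q.2)).re)) →
        -- … and uniformly bounded
        (∃ CE : ℝ, ∀ (j : ℕ) (X : (Sect2.domSys (F.P p.K) θ.τ9.M j).Dom) (z : Site (F.P p.K) j) (g' : ℝ) (U : GaugeField (F.P p.K) 0 (SU N)),
          |((t s.init).E j X z g' (Sect2.ofBackgroundC (settingOfRecord₁₃ F N θ.toStage13Params p).ι U)).re| ≤ CE) →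
        (∃ CR : ℝ, ∀ (j : ℕ) (X : (Sect2.domSys (F.P p.K) θ.τ9.M j).Dom) (U : GaugeField (F.P p.K) 0 (SU N)),
          |((t s.init).R j X (Sect2.ofBackgroundC (settingOfRecord₁₃ F N θ.toStage13Params p).ι U)).re| ≤ CR) →
        (∃ CB : ℝ, ∀ (j : ℕ) (X : (Sect2.domSys (F.P p.K) θ.τ9.M j).Dom) (U : GaugeField (F.P p.K) 0 (SU N)) (a : Tk.SFluct (F.P p.K) (FluctV N)),
          |((t s.init).B j X (Sect2.ofBackgroundC (settingOfRecord₁₃ F N θ.toStage13Params p).ι U) a).re| ≤ CB) →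
        (slotsTOfRecord F N θ.ν θ.τ9 (EOfRecord₁₃ F N θ.toStage13Params) (wOfRecord₉ F N θ.toStage9Params) θ.ppSel p
            (gOfRecord₁₃ F N θ.toStage13Params p) (k + 1) s = 0 ∨
          ∀ᵐ V' ∂fieldMeasure (F.P p.K) (k + 1) (SU N),
            chiSeqOfRecord F N θ.ν θ.τ9.M (gOfRecord₁₃ F N θ.toStage13Params p) p.K (k + 1) s V' ≠ 0 →
              slotsTOfRecord F N θ.ν θ.τ9 (EOfRecord₁₃ F N θ.toStage13Params) (wOfRecord₉ F N θ.toStage9Params) θ.ppSel p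
                  (gOfRecord₁₃ F N θ.toStage13Params p) (k + 1) s V' =
                sect2Slot F N (FluctV N) p.K (settingOfRecord₁₃ F N θ.toStage13Params p) (θ.rzAt p s) (WtOfRecord₁₃H F N θ p s) s
                  (t s.init) (Ek s.init) (UbgOfRecord₁₃CoP F N θ.toStage13Params p (k + 1) s) V') := by
  obtain ⟨t, Ek, hform, hloc, H⟩ := exists_local_witness_clause_succ_of_sLaw₁₃CoPH_of_termRows θ p h hU hk hM hS
  exact ⟨t, Ek, hform, hloc, fun s hΩ hpre hZ hq hqloc hζm hqm hcoer hE hR hB hEb hRb hBb =>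
    H s hΩ hpre hZ hq hqloc hζm hqm (afibre_rows_adm_of_coercive θ p s hcoer) hE hR hB hEb hRb hBb⟩

end Summit.QuantumFields.YangMills.Theorems.BalabanUVNodesN11NoExpansionStepSpecificationOfCoercive

end
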